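import Summits.HodgeConjecture.HodgeCM.Automorphic.WeilThetaModelDilation_1

/-! PORT of `HodgeCM/Automorphic/WeilThetaModelDilation.lean` (HodgeCMPerL run 82) — part 2: continuation of `Summits.HodgeConjecture.HodgeCM.Automorphic.WeilThetaModelDilation_1` (split at a top-level declaration boundary by port_pkg.py; scope re-opened below; declarations unchanged). -/

-- port_pkg: scope re-opened for this part (file-level context, then the namespace/section stack open at the cut)
set_option autoImplicit false
noncomputable section
open Topology Filter
open scoped RealInnerProductSpace SchwartzMap
namespace HodgeCM
namespace SchwartzWeil
section Model
variable (V : Type) [NormedAddCommGroup V] [InnerProductSpace ℝ V] [FiniteDimensional ℝ V] [MeasurableSpace V]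
  [BorelSpace V] (L : Submodule ℤ V) [DiscreteTopology L] (m : ℤ) (Γz : Subgroup Circle)
  (hΓz : ∀ z ∈ Γz, z ^ m = 1)
/-- The same in the literal shape of the end-state `smooth` field:
`((s:ℝ):ℂ)⁻¹ • (ω(inr (Dil.of s)) Φ − Φ) ⟶ x · ∇Φ` in `𝒮^κ` along `𝓝[≠] 0`. -/
theorem tendsto_dilationModel_of_sub_smul (Φ : 𝓢(V, ℂ)) :
    Tendsto (fun s : ℝ => ((s : ℝ) : ℂ)⁻¹ •
        ((dilationModel V L m Γz hΓz).omg (SemidirectProduct.inr (Dil.of s)) ⟨Φ, Set.mem_univ Φ⟩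
          - ⟨Φ, Set.mem_univ Φ⟩))
      (𝓝[≠] 0) (𝓝 (⟨flowGen (1 : V →L[ℝ] V) Φ, Set.mem_univ _⟩ : (dilationModel V L m Γz hΓz).SK)) := by
  have h := WeilThetaModel.hasSKDerivAt_zero_iff_tendsto_coe_smul.mp (hasSKDerivAt_dilationModel_of V L m Γz hΓz Φ)
  have h0 : (dilationModel V L m Γz hΓz).omg (SemidirectProduct.inr (Dil.of 0)) ⟨Φ, Set.mem_univ Φ⟩
      = ⟨Φ, Set.mem_univ Φ⟩ := by
    rw [Dil.of_zero, map_one]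
    exact (dilationModel V L m Γz hΓz).omg_one _
  simpa only [h0] using h

/-- **Differentiability at every parameter**: derivative `ω(inr (Dil.of s₀)) (x · ∇Φ)` at `s₀` (one-parameter
subgroup law + `ω` multiplicative + pv02-g7 `hasSKDerivAt_orbit_of_zero`). -/
theorem hasSKDerivAt_dilationModel_of_at (Φ : 𝓢(V, ℂ)) (s₀ : ℝ) :
    (dilationModel V L m Γz hΓz).HasSKDerivAt
      (fun s => (dilationModel V L m Γz hΓz).omg (SemidirectProduct.inr (Dil.of s)) ⟨Φ, Set.mem_univ Φ⟩)
      ((dilationModel V L m Γz hΓz).omg (SemidirectProduct.inr (Dil.of s₀))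
        ⟨flowGen (1 : V →L[ℝ] V) Φ, Set.mem_univ _⟩) s₀ :=
  WeilThetaModel.hasSKDerivAt_orbit_of_zero (fun s => SemidirectProduct.inr (Dil.of s)) _ _ s₀
    (fun s => by rw [Dil.of_add, map_mul, dilationModel_omg_mul])
    (hasSKDerivAt_dilationModel_of V L m Γz hΓz Φ)

/-- Heisenberg directions of the dilation model: derivative `dρ_m(a,b,c)Φ` (handover #3, from pv14-g6). -/
theorem hasSKDerivAt_dilationModel_heis (a b : V) (c : ℝ) (Φ : 𝓢(V, ℂ)) :
    (dilationModel V L m Γz hΓz).HasSKDerivAt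
      (fun s => (dilationModel V L m Γz hΓz).omg (SemidirectProduct.inl (Heis.expCurve a b c s))
        ⟨Φ, Set.mem_univ Φ⟩)
      ⟨schrodingerGen V m a b c Φ, Set.mem_univ _⟩ 0 :=
  hasSKDerivAt_adjoinCenterModel_inl_expCurve V L m _ _ Γz hΓz _ _ a b c Φ

/-- **The Leibniz rule on the non-commutative, non-compact pair `(Heis V, A)`**: along the "parabolic" curve
`s ↦ inl(γ_{a,b,c}(s)) · inr(Dil.of s)` — not a one-parameter subgroup — every Schwartz vector has `SK`-derivative
`dρ_m(a,b,c)Φ + x · ∇Φ` at `s = 0` (handover #1 `hasSKDerivAt_omg_mul_of_eq_one`, the Heisenberg factor being the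
continuous one). -/
theorem hasSKDerivAt_dilationModel_heis_mul_of (a b : V) (c : ℝ) (Φ : 𝓢(V, ℂ)) :
    (dilationModel V L m Γz hΓz).HasSKDerivAt
      (fun s => (dilationModel V L m Γz hΓz).omg
        (SemidirectProduct.inl (Heis.expCurve a b c s) * SemidirectProduct.inr (Dil.of s)) ⟨Φ, Set.mem_univ Φ⟩)
      (⟨schrodingerGen V m a b c Φ, Set.mem_univ _⟩ + ⟨flowGen (1 : V →L[ℝ] V) Φ, Set.mem_univ _⟩) 0 :=
  WeilThetaModel.hasSKDerivAt_omg_mul_of_eq_one (e₁ := fun s => SemidirectProduct.inl (Heis.expCurve a b c s))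
    (e₂ := fun s => SemidirectProduct.inr (Dil.of s))
    ((HeisSD.continuous_inl.comp (Heis.continuous_expCurve a b c)).continuousAt)
    (by simp only [Heis.expCurve_zero, map_one]) (by simp only [Dil.of_zero, map_one]) _
    (fun s => dilationModel_omg_mul V L m Γz hΓz _ _ _)
    (hasSKDerivAt_dilationModel_heis V L m Γz hΓz a b c Φ)
    (hasSKDerivAt_dilationModel_of V L m Γz hΓz Φ)

/-! ## 7. The theta kernel, and the bare theta series, differentiated along the dilation flow -/

/-- **The theta kernel along the dilation subgroup**: for every Schwartz `Φ`, every parameter `s₀` and every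
point `q` of `[U(1)] × [Heis V ⋊ A]`, `s ↦ θ_{ω(a(s))Φ}(q)` has derivative `θ_{ω(a(s₀))(x·∇Φ)}(q)` at `s₀` —
PerL's differentiation step (v5 l. 517) in the toy model, along a NON-COMPACT direction (pv02-g7
`hasDerivAt_θ_apply`: structural law `θ_cont` + the `SK`-derivative of §6). -/
theorem hasDerivAt_θ_dilationModel_of (Φ : 𝓢(V, ℂ)) (s₀ : ℝ)
    (q : (Circle ⧸ Γz) × ((Heis V ⋊[dilAut V] Dil) ⧸
      (arith V L m).map (SemidirectProduct.inl : Heis V →* Heis V ⋊[dilAut V] Dil))) :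
    HasDerivAt
      (fun s => (dilationModel V L m Γz hΓz).θ
        ((dilationModel V L m Γz hΓz).omg (SemidirectProduct.inr (Dil.of s)) ⟨Φ, Set.mem_univ Φ⟩) q)
      ((dilationModel V L m Γz hΓz).θ
        ((dilationModel V L m Γz hΓz).omg (SemidirectProduct.inr (Dil.of s₀))
          ⟨flowGen (1 : V →L[ℝ] V) Φ, Set.mem_univ _⟩) q) s₀ :=
  WeilThetaModel.hasDerivAt_θ_apply (hasSKDerivAt_dilationModel_of_at V L m Γz hΓz Φ s₀) q

/-- At the base point the theta kernel of `ω(a(s))Φ` IS the bare theta series of `L` along the flow: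
`θ_{ω(a(s))Ψ}(1, 1) = Σ_{v ∈ L} Ψ(e^s v)`. -/
theorem θ_dilationModel_of_one (Ψ : 𝓢(V, ℂ)) (s : ℝ) :
    (dilationModel V L m Γz hΓz).θ
        ((dilationModel V L m Γz hΓz).omg (SemidirectProduct.inr (Dil.of s)) ⟨Ψ, Set.mem_univ Ψ⟩)
        (QuotientGroup.mk 1, QuotientGroup.mk 1) = ∑' v : L, Ψ (Real.exp s • (v : V)) := by
  rw [WeilThetaModel.θ_mk, Prod.mk_one_one, inv_one, map_one, dilationModel_omg_inr]
  show thetaSD V L m (dil_intertwines V m) (SchwartzMap.compCLMOfContinuousLinearEquiv ℂ (dilation V s) Ψ) 1 = _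
  rw [thetaSD_def, repSD_one_apply, thetaH_one]
  rfl

/-- **Differentiation under the theta series along the dilation flow, as a COROLLARY of the structural laws**
(no termwise domination argument): for every Schwartz `Φ` on `V` and every `s₀`,
`d/ds|_{s₀} Σ_{v ∈ L} Φ(e^s v) = Σ_{v ∈ L} (x·∇Φ)(e^{s₀} v)` (the model with `m = 1`, `Γz = ⊥`, at the base
point). -/
theorem hasDerivAt_tsum_schwartz_dilation (Φ : 𝓢(V, ℂ)) (s₀ : ℝ) :
    HasDerivAt (fun s => ∑' v : L, Φ (Real.exp s • (v : V)))
      (∑' v : L, flowGen (1 : V →L[ℝ] V) Φ (Real.exp s₀ • (v : V))) s₀ := by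
  have hΓ : ∀ z ∈ (⊥ : Subgroup Circle), z ^ (1 : ℤ) = 1 := fun z hz => by
    rw [Subgroup.mem_bot] at hz
    rw [hz, one_zpow]
  have h := hasDerivAt_θ_dilationModel_of V L 1 ⊥ hΓ Φ s₀ (QuotientGroup.mk 1, QuotientGroup.mk 1)
  rw [θ_dilationModel_of_one, show (fun s => (dilationModel V L 1 ⊥ hΓ).θ ((dilationModel V L 1 ⊥ hΓ).omg
      (SemidirectProduct.inr (Dil.of s)) ⟨Φ, Set.mem_univ Φ⟩) (QuotientGroup.mk 1, QuotientGroup.mk 1)) =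
      fun s => ∑' v : L, Φ (Real.exp s • (v : V)) from funext fun s => θ_dilationModel_of_one V L 1 ⊥ hΓ Φ s]
    at h
  exact h

end Model

end SchwartzWeil
end HodgeCM

-- port_pkg: scope closed for this part
end
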